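import Summits.Ventures.PercRepro.TriangleCapEightH
import Summits.Ventures.PercRepro.S1TriangleQ2

/-!
# PercRepro — the triangle table from `P(8) = 13` (p3, gen 22; p2's LEMMA Q‴ device restarted one row later)

p2's recursion (`S1.cq2_step`: `s ≤ ⌊3s / m0 (d + 1)⌋ + cq2 d ⇒ s ≤ cq2 (d + 1)`) restarted at the theorem
`s₃ ≤ 13` at nullity `8` (TriangleCapEightH): `cq3 d` is the table
`0, 1, 2, 4, 5, 7, 10, 11, 13, 16, 20, 24, 29, 34, 40, 47, 54, 62, 71, 81, 92, 104, 117, 131, 146, 162, 179, 197, 216, 236`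
for `d ≤ 29` and `cq d` beyond (`cq3 ≤ cq2` everywhere; `cq3 9 = 16` is the clique-interpolation value `P_KK(9)`,
P3-TRIANGLE-CAP.md §10b).

* `cq3`, `cq3_le_cq2`, `cq3_eq_cq2_of_le_seven`, `cq3_step` — the table and its finite check;
* **`ncard_triangles_le_cq3`**, `core_ncard_triangles_le_cq3`.
Axioms: standard.
-/

open scoped Matroid

namespace PercRepro

namespace TriangleCap

open Set

variable {α : Type}

/-- `cq3 d`: the triangle bound at nullity `d` from `P(8) = 13` (the table for `d ≤ 29`, `cq d` beyond). -/
def cq3 (d : ℕ) : ℕ :=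
  if d ≤ 29 then
    [0, 1, 2, 4, 5, 7, 10, 11, 13, 16, 20, 24, 29, 34, 40, 47, 54, 62, 71, 81, 92, 104, 117, 131, 146, 162,
      179, 197, 216, 236].getD d 0
  else S1.cq d

/-- `cq3 ≤ cq2`. -/
theorem cq3_le_cq2 (d : ℕ) : cq3 d ≤ S1.cq2 d := by
  unfold cq3 S1.cq2
  split_ifs with h
  · interval_cases d <;> decide
  · exact le_rfl

/-- `cq3 d = cq2 d` for `d ≤ 7`. -/
theorem cq3_eq_cq2_of_le_seven {d : ℕ} (hd : d ≤ 7) : cq3 d = S1.cq2 d := by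
  unfold cq3 S1.cq2
  rw [if_pos (by omega), if_pos (by omega)]
  interval_cases d <;> rfl

/-- **The finite check of the restarted recursion**: for `8 ≤ d ≤ 28`, every `s ≤ 4·cq3 d` with
`s ≤ ⌊3s / m0 (d + 1)⌋ + cq3 d` satisfies `s ≤ cq3 (d + 1)`. -/
theorem cq3_step : ∀ d < 29, 8 ≤ d →
    ∀ s < 4 * cq3 d + 1, s ≤ 3 * s / S1.m0 (d + 1) + cq3 d → s ≤ cq3 (d + 1) := by
  decide +kernel

/-- **The triangle table from `P(8) = 13`.** Under (C1), (C2), (C3), a finite matroid with `|E| = r(E) + d` has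
at most `cq3 d` triangles. -/
theorem ncard_triangles_le_cq3 (M : Matroid α) [M.Finite]
    (hC1 : ∀ L ⊆ M.E, M.eRk L = 2 → L.ncard ≤ 3) (hC2 : ∀ P ⊆ M.E, M.eRk P ≤ 3 → P.ncard ≤ 6)
    (hC3 : ∀ X ⊆ M.E, M.eRk X ≤ 4 → X.ncard ≤ 10) {d : ℕ} (hd : M.E.encard = M.eRank + d) :
    (ThmN.triangles M).ncard ≤ cq3 d := by
  suffices H : ∀ n : ℕ, ∀ (M : Matroid α) [M.Finite], M.E.ncard = n →
      (∀ L ⊆ M.E, M.eRk L = 2 → L.ncard ≤ 3) → (∀ P ⊆ M.E, M.eRk P ≤ 3 → P.ncard ≤ 6) →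
      (∀ X ⊆ M.E, M.eRk X ≤ 4 → X.ncard ≤ 10) →
      ∀ d : ℕ, M.E.encard = M.eRank + d → (ThmN.triangles M).ncard ≤ cq3 d from
    H _ M rfl hC1 hC2 hC3 d hd
  intro n
  induction n using Nat.strong_induction_on with
  | _ n ih =>
  intro M _ hn hC1 hC2 hC3 d hd
  classical
  -- LEMMA Q covers `d ≤ 6` and `d ≥ 30`
  by_cases hd30 : 30 ≤ d
  · have : cq3 d = S1.cq d := by unfold cq3; rw [if_neg (by omega)]
    rw [this]
    exact S1.ncard_triangles_le_cq M hC1 hC2 hC3 hd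
  by_cases hd6 : d ≤ 6
  · rw [cq3_eq_cq2_of_le_seven (by omega), S1.cq2_eq_cq_of_le_six hd6]
    exact S1.ncard_triangles_le_cq M hC1 hC2 hC3 hd
  -- `d = 7` is p2's theorem `P(7) = 11`, `d = 8` is `P(8) = 13`
  by_cases hd7 : d = 7
  · subst hd7
    have : cq3 7 = 11 := by decide
    rw [this]
    exact S1.ncard_triangles_le_eleven_of_nullity_seven M hC1 hC2 hC3 hd
  by_cases hd8 : d = 8
  · subst hd8
    have : cq3 8 = 13 := by decide
    rw [this]
    exact ncard_triangles_le_thirteen_of_nullity_eight M hC1 hC2 hC3 hd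
  -- `9 ≤ d ≤ 29` from here; if there is no triangle, nothing to prove
  by_cases hs0 : (ThmN.triangles M).ncard = 0
  · rw [hs0]; exact Nat.zero_le _
  have hSfin : (ThmN.triangles M).Finite :=
    M.ground_finite.finite_subsets.subset (fun C hC => hC.1.subset_ground)
  obtain ⟨C, hC⟩ : (ThmN.triangles M).Nonempty := by
    rw [← Set.ncard_pos hSfin]; omega
  obtain ⟨r, hr, hnr, hr2⟩ := S1.two_add_le_eRank_of_triangle M hd hC
  have hE2 : r ≠ 2 ∨ M.E.ncard ≤ 3 := by
    by_cases h : r = 2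
    · refine Or.inr (hC1 M.E (subset_refl _) ?_)
      rw [← _root_.Matroid.eRank_def, hr, h]; norm_num
    · exact Or.inl h
  have hE3 : r ≠ 3 ∨ M.E.ncard ≤ 6 := by
    by_cases h : r = 3
    · refine Or.inr (hC2 M.E (subset_refl _) ?_)
      rw [← _root_.Matroid.eRank_def, hr, h]; norm_num
    · exact Or.inl h
  have hE4 : r ≠ 4 ∨ M.E.ncard ≤ 10 := by
    by_cases h : r = 4
    · refine Or.inr (hC3 M.E (subset_refl _) ?_)
      rw [← _root_.Matroid.eRank_def, hr, h]; norm_num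
    · exact Or.inl h
  have hm0 : S1.m0 d ≤ M.E.ncard := by
    unfold S1.m0
    split_ifs <;> omega
  -- a coloop: delete it and use the induction hypothesis
  by_cases hcol : ∃ k ∈ M.E, M.IsColoop k
  · obtain ⟨k, hkE, hk⟩ := hcol
    have hlt : (M ＼ {k}).E.ncard < n := by
      rw [_root_.Matroid.delete_ground, ← hn]
      exact Set.ncard_sdiff_singleton_lt_of_mem hkE M.ground_finite
    have hC1' : ∀ L ⊆ (M ＼ {k}).E, (M ＼ {k}).eRk L = 2 → L.ncard ≤ 3 := by
      intro L hL hr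
      rw [_root_.Matroid.delete_ground] at hL
      rw [delete_singleton_eRk_eq hL] at hr
      exact hC1 L (hL.trans Set.sdiff_subset) hr
    have hC2' : ∀ P ⊆ (M ＼ {k}).E, (M ＼ {k}).eRk P ≤ 3 → P.ncard ≤ 6 := by
      intro P hP hr
      rw [_root_.Matroid.delete_ground] at hP
      rw [delete_singleton_eRk_eq hP] at hr
      exact hC2 P (hP.trans Set.sdiff_subset) hr
    have hC3' : ∀ X ⊆ (M ＼ {k}).E, (M ＼ {k}).eRk X ≤ 4 → X.ncard ≤ 10 := by
      intro X hX hr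
      rw [_root_.Matroid.delete_ground] at hX
      rw [delete_singleton_eRk_eq hX] at hr
      exact hC3 X (hX.trans Set.sdiff_subset) hr
    have hd' : (M ＼ {k}).E.encard = (M ＼ {k}).eRank + d := S1.encard_delete_eq_of_isColoop M hk hd
    have := ih _ hlt (M ＼ {k}) rfl hC1' hC2' hC3' d hd'
    rwa [S1.triangles_delete_eq_of_isColoop M hk] at this
  have hcol' : ∀ x ∈ M.E, ¬ M.IsColoop x := fun x hx h => hcol ⟨x, hx, h⟩
  -- the coloop-free step: a point of degree `≤ ⌊3·s₃/m⌋` exists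
  have hm4 : 4 ≤ M.E.ncard := (S1.four_le_m0 (by omega)).trans hm0
  obtain ⟨x, hxE, hx⟩ : ∃ x ∈ M.E,
      (ThmN.trianglesThrough M x).ncard ≤ 3 * (ThmN.triangles M).ncard / M.E.ncard := by
    by_contra hno
    have hall : ∀ x ∈ M.E,
        3 * (ThmN.triangles M).ncard / M.E.ncard + 1 ≤ (ThmN.trianglesThrough M x).ncard := by
      intro x hx
      by_contra h
      exact hno ⟨x, hx, by omega⟩
    have h1 := S1.mul_ncard_ground_le_three_mul_ncard_triangles M
      (3 * (ThmN.triangles M).ncard / M.E.ncard + 1) hall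
    have h2 : 3 * (ThmN.triangles M).ncard <
        (3 * (ThmN.triangles M).ncard / M.E.ncard + 1) * M.E.ncard :=
      Nat.lt_mul_of_div_lt (Nat.lt_succ_self _) (by omega)
    omega
  -- delete `x`: nullity `d − 1`, at most `cq3 (d − 1)` triangles
  obtain ⟨d', rfl⟩ : ∃ d', d = d' + 1 := ⟨d - 1, by omega⟩
  obtain ⟨hd', hC1', hC2', hle⟩ :=
    S1.ncard_triangles_le_add_of_not_isColoop M hC1 hC2 (d := d') hd hxE (hcol' x hxE)
  have hC3' : ∀ X ⊆ (M ＼ {x}).E, (M ＼ {x}).eRk X ≤ 4 → X.ncard ≤ 10 := by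
    intro X hX hr
    rw [_root_.Matroid.delete_ground] at hX
    rw [delete_singleton_eRk_eq hX] at hr
    exact hC3 X (hX.trans Set.sdiff_subset) hr
  have hlt : (M ＼ {x}).E.ncard < n := by
    rw [_root_.Matroid.delete_ground, ← hn]
    exact Set.ncard_sdiff_singleton_lt_of_mem hxE M.ground_finite
  have hrec := ih _ hlt (M ＼ {x}) rfl hC1' hC2' hC3' d' hd'
  -- `s ≤ ⌊3s/m⌋ + cq3 d' ≤ ⌊3s/m0⌋ + cq3 d'`
  have hm0pos : 0 < S1.m0 (d' + 1) := by have := S1.four_le_m0 (d := d' + 1) (by omega); omega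
  have hdiv : 3 * (ThmN.triangles M).ncard / M.E.ncard ≤
      3 * (ThmN.triangles M).ncard / S1.m0 (d' + 1) := Nat.div_le_div_left hm0 hm0pos
  have hkey : (ThmN.triangles M).ncard ≤ 3 * (ThmN.triangles M).ncard / S1.m0 (d' + 1) + cq3 d' := by
    omega
  -- `s ≤ 4·cq3 d'` since `m0 ≥ 4`
  have h4 : 3 * (ThmN.triangles M).ncard / S1.m0 (d' + 1) ≤ 3 * (ThmN.triangles M).ncard / 4 :=
    Nat.div_le_div_left (S1.four_le_m0 (by omega)) (by norm_num)
  have hs4 : (ThmN.triangles M).ncard ≤ 4 * cq3 d' := by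
    have := Nat.div_mul_le_self (3 * (ThmN.triangles M).ncard) 4
    omega
  exact cq3_step d' (by omega) (by omega) _ (by omega) hkey


/-- **The table on the `e`-free core.** -/
theorem core_ncard_triangles_le_cq3 (M : Matroid α) [M.Finite]
    (hfree : ∀ e ∈ M.E, ∃ A ⊆ M.E \ {e}, e ∉ M.closure A ∧ e ∉ M.closure ((M.E \ {e}) \ A))
    {d : ℕ} (hd : M.E.encard = M.eRank + d) :
    {C : Set α | M.IsCircuit C ∧ C.ncard = 3}.ncard ≤ cq3 d := by
  have hL : ∀ e ∈ M.E, ¬ M.IsLoop e := ThmN.not_isLoop_of_free M hfree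
  have hline : ∀ L ⊆ M.E, M.eRk L = 2 → L.ncard ≤ 3 := by
    intro L hL' hr
    have := ThmN.ncard_add_one_le_two_pow_of_eRk_le M hL hfree 2 L hL' hr.le
    omega
  have hplane : ∀ P ⊆ M.E, M.eRk P ≤ 3 → P.ncard ≤ 6 := fun P hP hr =>
    ThmN.ncard_le_six_of_eRk_le_three_of_free M hfree hP hr
  have hsolid : ∀ X ⊆ M.E, M.eRk X ≤ 4 → X.ncard ≤ 10 := fun X hX hr =>
    ThmN.ncard_le_ten_of_eRk_le_four_of_free M hfree hX hr
  exact ncard_triangles_le_cq3 M hline hplane hsolid hd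

end TriangleCap

end PercRepro
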